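import Mathlib
import Summits.RiemannHypothesis.RiemannHypothesis.Theorems.PfPersistenceF2PlantedIndex
import Literature.MathematicalPhysics.QuantumFieldTheory.Balaban1983to89.B9Thm311

/-!
# PfPersistenceF2PlantedEnvelope — algebraic half of the planted-twin envelope P2-ENV

pub-rhpf-fake-2 (mechanism/rigidity campaign; no RH claims), FAKES.md §2.1.  A planted zero
quadruple changes a Galerkin block `A` (ζ's) into `A + c • (p pᵀ − q qᵀ)`, `c = 4w ≥ 0`,
`p + iq = (u_n(z))_n`.  The ENVELOPE statement used by the cell is: every Rayleigh quotient, hence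
every eigenvalue floor and every block-Lipschitz functional, moves by at most
`B := c (‖p‖² + ‖q‖²)`.  Here we prove the algebraic half at kernel level:

* `abs_dotProduct_planted_mulVec_le` : `|vᵀ (c (p pᵀ − q qᵀ)) v| ≤ c (p·p + q·q) (v·v)` (Cauchy–Schwarz,
  reusing `B9Thm311.dot_sq_le` and `PfPersistenceF2PlantedIndex.dotProduct_planted_mulVec`);
* `floor_of_planted` : a floor `ε (v·v) ≤ vᵀ A v` for all `v` passes to the floor `ε − c (p·p + q·q)`
  for the planted block, and `ceiling_of_planted` the symmetric statement — i.e. Weyl's inequality for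
  the bottom (and, through min–max, every) eigenvalue in the form the served records are read.

The analytic half (the size of `‖p‖² + ‖q‖² = Σ_n |u_n(η+iḡ)|² ≤ B(a,N)/4w` below the height reach
`πN/a < ḡ`) is NOT formalised here (THEOREM-informal in FAKES §2.1, constants DATA).
-/

namespace Summit.RiemannHypothesis.RiemannHypothesis.Theorems.PfPersistenceF2PlantedEnvelope

open Matrix BigOperators
open Summit.RiemannHypothesis.RiemannHypothesis.Theorems.PfPersistenceF2PlantedIndex
  (dotProduct_planted_mulVec)
open Literature.MathematicalPhysics.QuantumFieldTheory.Balaban1983to89.B9Thm311 (dot_sq_le)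

variable {n : Type*} [Fintype n]

/-- **Envelope, algebraic half.** `|vᵀ (c (p pᵀ − q qᵀ)) v| ≤ c (p·p + q·q) (v·v)` for `c ≥ 0`. -/
theorem abs_dotProduct_planted_mulVec_le (p q v : n → ℝ) {c : ℝ} (hc : 0 ≤ c) :
    |v ⬝ᵥ ((c • (vecMulVec p p - vecMulVec q q)) *ᵥ v)| ≤ c * (p ⬝ᵥ p + q ⬝ᵥ q) * (v ⬝ᵥ v) := by
  rw [dotProduct_planted_mulVec]
  have hp := dot_sq_le p v
  have hq := dot_sq_le q v
  have hp0 : 0 ≤ c * (p ⬝ᵥ v) ^ 2 := mul_nonneg hc (sq_nonneg _)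
  have hq0 : 0 ≤ c * (q ⬝ᵥ v) ^ 2 := mul_nonneg hc (sq_nonneg _)
  have hp1 : c * (p ⬝ᵥ v) ^ 2 ≤ c * ((p ⬝ᵥ p) * (v ⬝ᵥ v)) := mul_le_mul_of_nonneg_left hp hc
  have hq1 : c * (q ⬝ᵥ v) ^ 2 ≤ c * ((q ⬝ᵥ q) * (v ⬝ᵥ v)) := mul_le_mul_of_nonneg_left hq hc
  rw [abs_le]
  constructor
  · nlinarith
  · nlinarith

/-- **Weyl floor.** A Rayleigh floor `ε` of `A` passes to the floor `ε − c (p·p + q·q)` of the planted block. -/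
theorem floor_of_planted (A : Matrix n n ℝ) (p q : n → ℝ) {c ε : ℝ} (hc : 0 ≤ c)
    (hfloor : ∀ v : n → ℝ, ε * (v ⬝ᵥ v) ≤ v ⬝ᵥ (A *ᵥ v)) (v : n → ℝ) :
    (ε - c * (p ⬝ᵥ p + q ⬝ᵥ q)) * (v ⬝ᵥ v)
      ≤ v ⬝ᵥ ((A + c • (vecMulVec p p - vecMulVec q q)) *ᵥ v) := by
  rw [add_mulVec, dotProduct_add]
  have h1 := hfloor v
  have h2 := abs_dotProduct_planted_mulVec_le p q v hc
  have h3 := neg_abs_le (v ⬝ᵥ ((c • (vecMulVec p p - vecMulVec q q)) *ᵥ v))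
  nlinarith

/-- **Weyl ceiling.** Symmetrically, a Rayleigh ceiling `M` of `A` passes to `M + c (p·p + q·q)`. -/
theorem ceiling_of_planted (A : Matrix n n ℝ) (p q : n → ℝ) {c M : ℝ} (hc : 0 ≤ c)
    (hceil : ∀ v : n → ℝ, v ⬝ᵥ (A *ᵥ v) ≤ M * (v ⬝ᵥ v)) (v : n → ℝ) :
    v ⬝ᵥ ((A + c • (vecMulVec p p - vecMulVec q q)) *ᵥ v)
      ≤ (M + c * (p ⬝ᵥ p + q ⬝ᵥ q)) * (v ⬝ᵥ v) := by
  rw [add_mulVec, dotProduct_add]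
  have h1 := hceil v
  have h2 := abs_dotProduct_planted_mulVec_le p q v hc
  have h3 := le_abs_self (v ⬝ᵥ ((c • (vecMulVec p p - vecMulVec q q)) *ᵥ v))
  nlinarith

/-- **Twin reading.** If the planted vectors are small, `c (p·p + q·q) ≤ B`, then a window whose
ζ-floor is `ε` has planted floor at least `ε − B`: a functional reading the floor at resolution
coarser than `B` cannot tell the two blocks apart (the door-row statement of CLOSED-CLASSES §E-D,
with `B` supplied by the analytic envelope). -/
theorem floor_of_planted_of_le (A : Matrix n n ℝ) (p q : n → ℝ) {c ε B : ℝ} (hc : 0 ≤ c)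
    (hB : c * (p ⬝ᵥ p + q ⬝ᵥ q) ≤ B)
    (hfloor : ∀ v : n → ℝ, ε * (v ⬝ᵥ v) ≤ v ⬝ᵥ (A *ᵥ v)) (v : n → ℝ) :
    (ε - B) * (v ⬝ᵥ v) ≤ v ⬝ᵥ ((A + c • (vecMulVec p p - vecMulVec q q)) *ᵥ v) := by
  have h := floor_of_planted A p q hc hfloor v
  have hvv : 0 ≤ v ⬝ᵥ v := by
    have : v ⬝ᵥ v = ∑ i, v i ^ 2 := by simp [dotProduct, pow_two]
    rw [this]; exact Finset.sum_nonneg fun i _ => sq_nonneg _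
  nlinarith

end Summit.RiemannHypothesis.RiemannHypothesis.Theorems.PfPersistenceF2PlantedEnvelope

#print axioms Summit.RiemannHypothesis.RiemannHypothesis.Theorems.PfPersistenceF2PlantedEnvelope.abs_dotProduct_planted_mulVec_le
#print axioms Summit.RiemannHypothesis.RiemannHypothesis.Theorems.PfPersistenceF2PlantedEnvelope.floor_of_planted_of_le
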